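import Summits.Schanuel.Schanuel.Theorems.RootDecomp1EUntwistedWall04
import Summits.Schanuel.Schanuel.Theorems.RootDecomp1KFiniteOrderCell02

/-!
# RootDecomp1ERadixCell — lens 2, generation 42 «THE FINITE-ORDER RADIX-2 CELL: count CONJUGATES, not degree» (lanes E-R19 (i) T below hyper + (iii) the transcendental weight log 2): S ITSELF on the pure-radix class {z_l = (v_l·log 2)·T^{e_l}, T real of FIXED finite exponential order} HYPOTHESIS-FREE and on the mixed radix class {z_l = (u_l + v_l log 2)·T^{e_l}} mod the ONE tree fact hX = ExplicitRatExpApprox — the Kummer-direction degree is paid by COUNTING the 𝔐 conjugates of 2^{1/𝔐} through the resultant norm Res_Y(Y^𝔐 − 2, F), never by a pair measure — part 1 (RootDecomp1ERadixCell01): §1 the radix field ℚ(2^{1/𝔐})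

(lens-2 g42 HOME kernel RadixCell.lean d9530aae…, 1851 l, imports tree RootDecomp1EUntwistedWall04 + RootDecomp1KFiniteOrderCell02 only; CLAIM L2067, ACK + CHECKLIST E-g42 L2069, NODE L2089 / REQUEST L2090, critic VERDICT L2095 (crit g8: CLEARED — ONE CELL, tiers 1+2 = one cell; lens-2 tally CELL ×4 (g37, g39, g41, g42); E-R20 closes the radix line; PORT GO `--supports stmt-Schanuel-31410`); port by census-1 gen 18 as `RootDecomp1ERadixCell01`–`08` along K's sections: 01 = §1 the radix field ℚ(2^{1/𝔐}) (`croot`, `zroot`, `broot`, `irreducible_X_pow_sub_two`, degree 𝔐); 02 = §2 the two-level polynomial, conjugate factors `Gfac`, the RESULTANT NORM `resNorm` (`map_resNorm` = ∏ conjugates, `resNorm_ne_zero`, degree / value / Mahler-measure bounds); 03 = §3 the radix curve point `radixPt`, germs, fibres, root and residue avoidance at transcendental parameters; 04 = §4 integral exponents at the collapse (`Mden`, `Aexp`, `Bexp`, the value of G₀, from avoidance to the hypotheses of `resNorm_ne_zero`); 05 = §5 THE PURE-RADIX ENGINE `algebraicIndependent_radixPt_pure` (hypothesis-free, `endgame_pure`)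 + §5b mixed-engine helpers; 06 = §5b THE MIXED ENGINE `algebraicIndependent_radixPt (hX)` (one 320-line theorem, scoped `maxHeartbeats 800000` carried as in K); 07 = §6 classes `InPureRadixClass` / `InRadixClass`, `schanuel_inPureRadixClass` (hyp-free) / `schanuel_inRadixClass (hX)`, cells `cell_31410(_pure)` / `cell_25020(_pure)`, members `zLog2Curve` / `zMix` at tower numbers; 08 = §6 items AT the members + separation (`zMix_not_inPointClass`, `zLog2Curve_not_inPointClass`, `zMix_separation`).
PORT EDITS: 37 one-line docstrings added; five generic helpers made `private` against dedup twins (`mahlerMeasure_finset_prod`, `eval_map_intCast`, `aeval_ne_zero_of_transcendental`, `addNat_eq_natAdd`, `transcendental_log_two` ≡ tree AclSubsetLogFreeCore/Negative) with per-part private copies; statements and proofs verbatim. `--supports stmt-Schanuel-31410`; no census credit carried; rung 0 — nothing here proves Schanuel.)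
-/

/-!
# RootDecomp1ERadixCell — lens 2 («structural dichotomy: special vs generic»), generation 42
# «THE FINITE-ORDER RADIX-2 CELL: count CONJUGATES, not degree»

Route `route-Schanuel-RootDecomp1E` (thesis `Theses/RootDecomp1E.lean`); items served POSITIONALLY (they stay OPEN):
`stmt-Schanuel-25020 DefectOneSchanuel`, `stmt-Schanuel-31410 PlainDefectOne` (binders verbatim + ONE class line).
`stmt-Schanuel-31409 EStableDefectOne` is NOT served (observation only, see `cell_31410`).  `Schanuel` is NOT derived.

## Thesis of the cell (special side of the dichotomy, E-R19 (i)+(iii))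

DATA: `n`, weights `w : Fin n → ℚ × ℚ` read as `ρr (u,v) = u + v·log 2 ∈ ℚ + ℚ·log 2` (`u = (w l).1 ≥ 0`,
`v = (w l).2 ≥ 0`, and `v_l = 0` wherever `e_l = 0`), exponents `e : Fin n → ℕ`, ONE real parameter `T > 0` of FINITE
exponential order (`RootDecomp1KGeneric.LiouvilleOrder k T`: infinitely many rationals `p/q` with `|T − p/q| < exp(−q^k)`),
freeness of the monomials `gι(w l)·X^{e l}` over `ℤ` in `ℂ[X]` (g41's condition VERBATIM; `gι (u,v) = u + i v` is an exact
bookkeeping proxy for `u + v log 2`, both being `ℚ`-bases `{1, i}` / `{1, log 2}`).  The point is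
`radixPt w e T = (T, e^{ρ(w₁)T^{e₁}}, …, e^{ρ(wₙ)T^{eₙ}})`, i.e. the numbers `e^{u_l T^{e_l}} · 2^{v_l T^{e_l}}`.

CLAIM: `radixPt w e T` is algebraically independent over `ℚ` —
* TIER 1 (`algebraicIndependent_radixPt_pure`, §5): all `u_l = 0` (pure radix weights `v_l log 2`), order `Σ e + 3`,
  NO fact binder at all (kernel axioms `propext, Classical.choice, Quot.sound`);
* TIER 2 (`algebraicIndependent_radixPt`, §5b): mixed weights, order `13·Σ e + 4`, modulo the ONE tree fact
  `hX : RootDecomp1KHyper.HyperCell.ExplicitRatExpApprox` (tree def `RootDecomp1KHyper06` l.75, BY NAME: Waldschmidt's 1978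
  approximation measure `‖e^r − ξ‖ ≥ exp(−C₀(r)·n²·Y·(log Y + log n)²/(log Y)²)` for `r ∈ ℚ^×`, `ξ` algebraic of degree
  `n`, `log M(ξ) ≤ Y` — verbatim the conclusion of the tree's `Waldschmidt1978.approx_measure_exp_alg`, a PROVABLE
  support statement carried as a hypothesis exactly as in 1K/g32), nothing else.
Hence `S` itself (`SB n z`, `trdeg ℚ(z, e^z) ≥ n`) on the classes `InPureRadixClass` / `InRadixClass` (§6), the two live
items by one line each, and NAMED MEMBERS at lens-1's tower numbers `towerNumber c` (finite order BY NAME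
`liouvilleOrder_towerNumber`, NOT hyper-Liouville BY NAME `not_hyperLiouville_towerNumber`).

## The engine (why finite order suffices once a `log 2` weight is present): COUNT CONJUGATES

At a good rational `r = p/q` near `T` put `𝔐 := Mden w e r = wden w · q^{Σ e}` (so every `𝔐·u_l r^{e_l}`, `𝔐·v_l r^{e_l}`
is a natural number `Aexp`, `Bexp`), `x := e^{1/𝔐}`, `c := 2^{1/𝔐}` (`croot`).  A putative relation `P(radixPt) = 0`,
cleared of denominators and pushed to the fibres of the exponent map (g41's `expo/coef/tail/fib` VERBATIM), becomes a
two-level integer polynomial `twoLevel (X) (Y) = Σ_D coef_D · X^{A_D} · Y^{B_D}` evaluated at `(x, c)`.  Instead of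
bounding the DEGREE of `ℚ(x, c)` (hyper-Liouville territory) we take the RESULTANT in `Y` with the `2`-Eisenstein
polynomial `Y^𝔐 − 2` (`resNorm`, Mathlib `Polynomial.resultant`): `R₀ := Res_Y(Y^𝔐 − 2, twoLevel) ∈ ℤ[X]`, and
`map_resNorm : R₀ = ∏_{i<𝔐} Gfac i`, `Gfac i (X) = twoLevel(X, ζ^i c)` over `ℚ(ζ_𝔐, c)`.  KEY COUNT: `deg_X R₀ ≤ 𝔐 · max A`
and `M(R₀) ≤ (Σ|coef| x^{A})^𝔐` — the number of conjugates is `𝔐 ~ q^{Σe}`, POLYNOMIAL in `q`, where a degree bound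
for `x = e^{1/𝔐}` over `ℚ(c)` would be useless.  `R₀ ≠ 0` (`resNorm_ne_zero`): `Y^𝔐 − 2` is irreducible for EVERY `𝔐 ≥ 1`
(`irreducible_X_pow_sub_two`, Eisenstein at `2` via Mathlib, no primality needed) and no `Gfac i` vanishes identically
because the fibre sums avoid the residues (`AvoidAt`, obtained from the TRANSCENDENCE of `T` — `eventually_avoid` — which
is where `Transcendental ℚ T`, a consequence of finite positive order, enters).  `G₀(x) = q^{deg}·F_R(r)` (`eval_Gfac_zero`)
is exponentially small by the Liouville approximation while `R₀(x)` is a nonzero algebraic integer combination: Tier 1 has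
`A ≡ 0`, so `R₀` is a nonzero INTEGER CONSTANT and `|G₀(x)| · ∏_{i≠0} |G_i(x)| ≥ 1` contradicts smallness outright
(`endgame_pure`, order budget `K + 2 ≤ K + 3`, `K = Σ e`); Tier 2 feeds `R₀(x)`, `x = e^{1/𝔐}`, to `hX` through the tree's
`measure_factor_le` / `C₀rat_le` / `endgame_gen (D := 0)` with exponents `a = 11K+1`, `b = 2K`, `m = 13K+3` (ORDER BUDGET
`C·q^{a+b+1} ≤ q^m` proved in Lean, no hidden numeral; class order `13K+4 = m+1` gives the slack line).

## Why this is NOT an instance of anything decided in the tree (one line each; details in NODE-g42 §4)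
* 1K Kummer/log cells (`hyperCell_ratLog2_any`, `sb_kummer_of_mem`, `hyperCell_logAlg_any`) need the parameter
  HYPER-Liouville and carry `hNW`; ours has FINITE order (named non-hyper member) and Tier 1 carries NOTHING.
* lens-1 g32 `algebraicIndependent_curvePt_of_liouvilleOrder` (finite order `7n+3`, mod `hX`) is the PURE-`u` slice
  `v ≡ 0` — route-1 territory, NOT claimed here; every member below has a `log 2`-weight PRESENT, and Tier 1 is even
  `hX`-free, which no rational-weight finite-order cell can be by this method.
* g41 `InGaussCurveClass` (weights `ℚ(i)`, `T` hyper): our weights `u + v log 2`, `v ≠ 0`, are outside `ℚ(i)` (`ρι_ne_gι`,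
  from the tree's Hermite–Lindemann `transcendental_exp_holds`), and our `T` is not hyper.
* `InPointClass` (g36): refuted for the members by name (`zMix_not_inPointClass`, `zLog2Curve_not_inPointClass`).
* `InScaleClass` / `InLWClass` / `InTwistedFrameClass` / `InTwoScaleClass` via some OTHER parameter: membership OPEN
  (a Diophantine question about tower numbers), not claimed either way.

## Literature position (labels in NODE-g42 §8)
Nearest print statement: Waldschmidt–Zhu 1990, *Algebraic independence of certain numbers related to Liouville numbers*
(Sci. China A 33), Thm 1.2.2 / Cor 1.2.1 — algebraic independence of `e^{α₁ ξ}, …` / `2^{ξ^j}`-type values for `ξ` a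
LIOUVILLE-type number with a growth condition of «hyper» strength (successive approximations `q_{k+1} > q_k^{ψ(q_k)}`,
`ψ → ∞`); the present cell asks only FINITE order `Σe+3` and, in Tier 1, uses no transcendence measure at all — the
resultant-with-`Y^𝔐−2` count replaces the measure.  Grade claimed ex ante: NEW-COMBINATION-LOCAL (lineage scale).

## Contents
§1 radicals of 2 (`croot`, `broot`, `irreducible_X_pow_sub_two`, `minpoly_broot`) · §2 the two-level polynomial, `Gfac`,
`resNorm`, `map_resNorm`, non-vanishing, degree and Mahler-measure bounds · §3 the point `radixPt`, the real germ `FR`,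
fibre decomposition, transcendence from finite order, residue avoidance near `T` · §4 the collapse at `r = p/q`
(`Mden`, `Aexp`, `Bexp`, `eval_Gfac_zero`, `AvoidAt`, `hsum_of_avoid`) · §5 Tier 1 engine (`endgame_pure`,
`algebraicIndependent_radixPt_pure`) · §5b Tier 2 engine (`algebraicIndependent_radixPt`, mod `hX`) · §6 classes, cells of
25020/31410 (both tiers), members `zLog2Curve`, `zMix` at `towerNumber`, items at members, separation.

CERTIFICATE: `lean check` rc 0, 0 `sorry`; every theorem's axioms = `propext, Classical.choice, Quot.sound`; controls in
`RadixCellCtrl.lean` (§C, each must-fail example errs), read-backs in `RadixCellProbe.lean`.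
-/

noncomputable section

open Complex Polynomial IntermediateField Filter
open scoped BigOperators Topology

namespace Summit.Schanuel.Schanuel.Theorems.RootDecomp1ERadixCell

open Summit.Schanuel.Schanuel.Theorems.RootDecomp1EUntwistedWall (gι gaussPt expo coef tail fib IsZ wden wden_pos
  isZ_expo Wb Wb_nonneg abs_expo_le abs_coef_le expo_eq_of_tail_eq sum_coef_fibre_cast fib_ne_zero diffPoly
  diffPoly_ne_zero eval_diffPoly gι_expo_sub gι_injective tail_eq_of_expo_eq eq_of_tail_eq_of_zero_eq coef_cast
  IsZ.add IsZ.mul IsZ.natCast IsZ.sum isZ_wden_fst isZ_wden_snd InGaussCurveClass)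
open Summit.Schanuel.Schanuel.Theorems.RootDecomp1EPointTransfer (InPointClass)
open Summit.Schanuel.Schanuel.Theorems.RootDecomp1ETwoScale (InTwoScaleClass)
open Summit.Schanuel.Schanuel.Theorems.RootDecomp1EWallDichotomy (InTwistedFrameClass)
open Summit.Schanuel.Schanuel.Theorems.RootDecomp1KHyper
open Summit.Schanuel.Schanuel.Theorems.RootDecomp1KHyper.HyperCell
open Summit.Schanuel.Schanuel.Theorems.RootDecomp1KGeneric (LiouvilleOrder)
open Summit.Schanuel.Schanuel.Theorems.RootDecomp1KFiniteOrderCell (towerNumber liouvilleOrder_towerNumber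
  not_hyperLiouville_towerNumber towerNumber_pos not_liouvilleOrder_towerNumber)
open Summit.Schanuel.Schanuel.Theorems.RootDecomp1BDefectFloorCells (natCast_le_trdeg_of_algebraicIndependent)

/-! ## §1  The radix field `ℚ(2^{1/𝔐})`: the root `c_𝔐 = 2^{1/𝔐}`, its conjugates, its degree `𝔐` -/

/-- The positive real `𝔐`-th root of `2`: `c_𝔐 = exp(log 2 / 𝔐)`. -/
def croot (M : ℕ) : ℝ := Real.exp (Real.log 2 / M)

/-- `0 < c_𝔐`. -/
theorem croot_pos (M : ℕ) : 0 < croot M := Real.exp_pos _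

/-- `1 ≤ c_𝔐`. -/
theorem one_le_croot (M : ℕ) : 1 ≤ croot M := by
  unfold croot
  exact Real.one_le_exp (div_nonneg (Real.log_nonneg (by norm_num)) (Nat.cast_nonneg M))

/-- `c_𝔐 ≤ 2`. -/
theorem croot_le_two (M : ℕ) : croot M ≤ 2 := by
  unfold croot
  rcases Nat.eq_zero_or_pos M with hM | hM
  · subst hM; simp
  · calc Real.exp (Real.log 2 / M) ≤ Real.exp (Real.log 2) := by
          refine Real.exp_le_exp.mpr (div_le_self (Real.log_nonneg (by norm_num)) ?_)
          exact_mod_cast hM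
      _ = 2 := Real.exp_log (by norm_num)

/-- `c_𝔐 ^ 𝔐 = 2` (for `𝔐 ≠ 0`). -/
theorem croot_pow {M : ℕ} (hM : M ≠ 0) : croot M ^ M = 2 := by
  unfold croot
  rw [← Real.exp_nat_mul, mul_div_cancel₀ _ (by exact_mod_cast hM : (M : ℝ) ≠ 0), Real.exp_log (by norm_num)]

/-- `c_𝔐^k = exp(k · log 2 / 𝔐)` (real powers of the radix root are radix exponentials). -/
theorem croot_pow_eq_exp (M k : ℕ) : croot M ^ k = Real.exp ((k : ℝ) * (Real.log 2 / M)) := by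
  unfold croot
  rw [← Real.exp_nat_mul]

/-- A primitive `𝔐`-th root of unity. -/
def zroot (M : ℕ) : ℂ := cexp (2 * Real.pi * I / M)

/-- `ζ_𝔐 = exp(2πi/𝔐)` is a primitive `𝔐`-th root of unity. -/
theorem isPrimitiveRoot_zroot {M : ℕ} (hM : M ≠ 0) : IsPrimitiveRoot (zroot M) M :=
  Complex.isPrimitiveRoot_exp M hM

/-- The conjugates `b_i = ζ^i · c_𝔐` (`i < 𝔐`) of the radix root. -/
def broot (M i : ℕ) : ℂ := zroot M ^ i * (croot M : ℂ)

/-- `‖ζ_𝔐‖ = 1`. -/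
theorem norm_zroot {M : ℕ} (hM : M ≠ 0) : ‖zroot M‖ = 1 :=
  (isPrimitiveRoot_zroot hM).norm'_eq_one hM

/-- Every conjugate `ζ_𝔐^i c_𝔐` has absolute value `c_𝔐`. -/
theorem norm_broot {M : ℕ} (hM : M ≠ 0) (i : ℕ) : ‖broot M i‖ = croot M := by
  rw [broot, norm_mul, norm_pow, norm_zroot hM, one_pow, one_mul, Complex.norm_real,
    Real.norm_of_nonneg (croot_pos M).le]

/-- Every conjugate `ζ_𝔐^i c_𝔐` is an `𝔐`-th root of `2`. -/
theorem broot_pow {M : ℕ} (hM : M ≠ 0) (i : ℕ) : broot M i ^ M = 2 := by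
  rw [broot, mul_pow, ← pow_mul, mul_comm i M, pow_mul, (isPrimitiveRoot_zroot hM).pow_eq_one, one_pow,
    one_mul, ← Complex.ofReal_pow, croot_pow hM]
  norm_num

/-- The `0`-th conjugate is the real root `c_𝔐`. -/
theorem broot_zero (M : ℕ) : broot M 0 = (croot M : ℂ) := by simp [broot]

/-- `X^𝔐 − 2` is irreducible over `ℚ` (Eisenstein at `2` + Gauss). -/
theorem irreducible_X_pow_sub_two {M : ℕ} (hM : 0 < M) : Irreducible (X ^ M - C (2 : ℚ)) := by
  have hf : (X ^ M - C (2 : ℤ) : ℤ[X]).Monic := monic_X_pow_sub_C _ hM.ne'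
  have hprim : (X ^ M - C (2 : ℤ) : ℤ[X]).IsPrimitive := hf.isPrimitive
  have hP : (Ideal.span {(2 : ℤ)}).IsPrime :=
    (Ideal.span_singleton_prime (by norm_num)).mpr Int.prime_two
  have hirr : Irreducible (X ^ M - C (2 : ℤ) : ℤ[X]) := by
    refine irreducible_of_eisenstein_criterion hP ?_ ?_ ?_ ?_ hprim
    · rw [hf.leadingCoeff, Ideal.mem_span_singleton]; norm_num
    · intro n hn
      rw [degree_X_pow_sub_C hM, Nat.cast_lt] at hn
      rw [coeff_sub, coeff_X_pow, coeff_C]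
      by_cases h0 : n = 0
      · subst h0
        rw [if_neg (by omega), if_pos rfl, zero_sub]
        exact Submodule.neg_mem _ (Ideal.mem_span_singleton_self 2)
      · rw [if_neg (by omega), if_neg h0, sub_zero]; exact Ideal.zero_mem _
    · rw [degree_X_pow_sub_C hM]; exact_mod_cast hM
    · rw [coeff_sub, coeff_X_pow, coeff_C, if_neg (by omega), if_pos rfl, zero_sub, Ideal.span_singleton_pow,
        neg_mem_iff, Ideal.mem_span_singleton]
      norm_num
  have := (IsPrimitive.Int.irreducible_iff_irreducible_map_cast hprim).mp hirr
  rwa [Polynomial.map_sub, Polynomial.map_pow, Polynomial.map_X, Polynomial.map_C, map_ofNat] at this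

/-- The minimal polynomial of each conjugate `b_i` over `ℚ` is `X^𝔐 − 2`; in particular `[ℚ(b_i):ℚ] = 𝔐`. -/
theorem minpoly_broot {M : ℕ} (hM : 0 < M) (i : ℕ) : minpoly ℚ (broot M i) = X ^ M - C (2 : ℚ) := by
  refine (minpoly.eq_of_irreducible_of_monic (irreducible_X_pow_sub_two hM) ?_ (monic_X_pow_sub_C _ hM.ne')).symm
  rw [map_sub, map_pow, aeval_X, aeval_C, broot_pow hM.ne', eq_ratCast]
  norm_num

/-- A non-zero integer polynomial of degree `< 𝔐` does not vanish at a conjugate of `2^{1/𝔐}`. -/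
theorem aeval_broot_ne_zero {M : ℕ} (hM : 0 < M) (i : ℕ) {H : ℤ[X]} (hH : H ≠ 0) (hdeg : H.natDegree < M) :
    aeval (broot M i) H ≠ 0 := by
  intro h0
  have h1 : aeval (broot M i) (H.map (Int.castRingHom ℚ)) = 0 := by
    rwa [← algebraMap_int_eq, aeval_map_algebraMap]
  have hne : H.map (Int.castRingHom ℚ) ≠ 0 := (Polynomial.map_ne_zero_iff (RingHom.injective_int _)).mpr hH
  have h2 := minpoly.degree_le_of_ne_zero ℚ (broot M i) hne h1
  rw [minpoly_broot hM i, degree_X_pow_sub_C hM, degree_eq_natDegree hne,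
    natDegree_map_eq_of_injective (RingHom.injective_int _), Nat.cast_le] at h2
  omega

end Summit.Schanuel.Schanuel.Theorems.RootDecomp1ERadixCell

end
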